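/-
Copyright (c) 2026. All rights reserved.
Released under Apache 2.0 license as described in the file LICENSE.
Authors: abc-iut cell, statement-typer seat abc-iut-L4-t3 (wave 1; gen 9), owner of the §5 interface, over abc-iut-L4-t6's
`⋉`-carrier `archGenuinePlus` + `η⊢`, abc-iut-L4-t8's `⋉`-twins of abc-iut-f-101's contact-structure chain, and this lineage's
`⋉`-twins of its `ι`-side (`Ltimes/LogFrobeniusMonoTelecoreIotaContact`).
-/
import Literature.AnabelianGeometry.AbsoluteAnabelian.Ltimes.LogFrobeniusArchGenuinePlusEtaNatural
import Literature.AnabelianGeometry.AbsoluteAnabelian.Ltimes.LogFrobeniusMonoTelecoreIotaContact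
import Literature.AnabelianGeometry.AbsoluteAnabelian.Ltimes.LogFrobeniusArchGenuinePlusPinned
import HarnessLib

/-!
# [AbsTopIII] Cor 5.10 (iv)(b)(c), archimedean clauses: the `ι`-side node closer `Cor510MonoTelecorePinnedIota` HOLDS at the genuine `⋉`-carrier

S. Mochizuki, *Topics in absolute anabelian geometry III*, J. Math. Sci. Univ. Tokyo 22 (2015) [MochizukiAbsTopIII2015];
manuscript `paper:url-5493eb38cbb7`, Cor 5.10 (iv)(b)(c) pp. 147–148 (the telecore `𝔗_{An⊢}`; "the resulting homotopies
`η⊢_{v,ν}`, `(η⊢_{v,ν})⁻¹`, together with … the homotopies … arising from the `ι^{An⊢⊞}_{v,ε}` [cf. Proposition 5.8, (vii)],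
generate a contact structure `ℋ_{An⊢}` on `𝔗_{An⊢}`").

## What this file proves (cell row «LTIMES-SUCCESSOR», M1 of L4-lead m170 — L4-t3's share per m185)

★★★ `archGenuinePlus_cor510MonoTelecorePinnedIota` — at abc-iut-L4-t6's carrier `archGenuinePlus 𝔄 V (fun _ => true)` (all places
archimedean, `𝒩⊞_v := 𝒞^hol_{TH⊞}`, genuine `𝒩⊞_v → TM⊢ × TB⊞`), under an orientation cochain `(c, hc, hcob)`, this lineage's
print-faithful row F-0139″ `Cor510MonoTelecorePinnedIota` HOLDS: there are mono-analyticization homotopies `M`, a coherence datum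
`K` (abc-iut-L4-t6: `η⊢` = abc-iut-w5-d038's `etaTilde`/`etaTimes`), an `ι^{An⊢⊞}`-datum `I` (abc-iut-w6-d025's `gammaArc`) with
`K.EtaNatural I` (this lineage, `archGenuinePlus_etaNatural`), and a contact structure on the telecore `𝔗_{An⊢}` compatible with
`𝒥`, containing the pinned `η⊢`-pairs `(γ¹_{v,ν}, γ⁰_{v,ν})` in both orders and every `ι^{An⊢⊞}`-pair with homotopy `ι^{An⊢⊞}_{v,ε}` —
by ONE application of the `⋉`-twin of this lineage's sufficiency theorem `MonoTelecoreCoherence.cor510MonoTelecorePinnedIota_of`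
(the contact family is abc-iut-f-101's `relFamily` over `monoRelLiftsIota`, re-elaborated over the successor by abc-iut-L4-t8 and
this seat).  ★★★ `HolRS.archGenuinePlus_cor510MonoTelecorePinnedIota_geometric` — ZERO hypotheses at abc-iut-w5-d226's geometric
Aut-holomorphic field functor (the cochain exists there).  The pinned row `Cor510MonoTelecorePinned` alone (the `η⊢`-pairs) is abc-iut-L4-t6's
`archGenuinePlus_cor510MonoTelecorePinned(_geometric)` (`Ltimes/LogFrobeniusArchGenuinePlusPinned`), not repeated here.

CONTRAST (why the successor exists): over the FROZEN interface the same rows are conditional on a kernel-EMPTY hypothesis at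
every print-shaped archimedean carrier (`isEmpty_monoTelecoreCoherence_archGenuineMonoAnChart`, typing finding T3g9-F1); over
the `⋉`-successor (`ι⊞` on `Γ⃗^⋉_v` only, Cor 5.5 (iii) p. 131) they are THEOREMS at a carrier whose `𝒩⊞_v` IS `𝒞^hol_{TH⊞}`.
HONEST LIMITS: the carrier's ((L-N⊢) `𝒩⊢_v := TM⊢`, nonarchimedean stand-ins unused at an all-arc index), strict naturality
hence the cochain (none at the geometric functor), ι-pairs one way, `V ≠ ∅`.  MODEL-LEVEL; refereed pre-IUT material; nothing here
bears on [IUTchIII] Cor. 3.12; no side taken; typed ≠ proved.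
-/

set_option autoImplicit false

noncomputable section

open CategoryTheory

universe u

namespace Literature.AnabelianGeometry.AbsoluteAnabelian

namespace LogFrobeniusSettingLtimes

variable (𝔄 : AutHolFieldFunctor.{u}) (V : Type (u + 1)) [Nonempty V]

/-- ★★★ **F-0139″ (`Cor510MonoTelecorePinnedIota`: the pinned `η⊢`-pairs AND the `ι^{An⊢⊞}`-pairs in ONE contact structure on
`𝔗_{An⊢}`, with the `ι–η` square) HOLDS at the genuine archimedean `⋉`-carrier**, under an orientation cochain.
[cite: MochizukiAbsTopIII2015, Cor 5.10 (iv)(c) p. 148] -/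
theorem archGenuinePlus_cor510MonoTelecorePinnedIota (c : 𝔄.EA → ℝ) (hc : ∀ X : 𝔄.EA, c X = 1 ∨ c X = -1)
    (hcob : ∀ {X Y : 𝔄.EA} (f : X ⟶ Y), AutHolFieldFunctor.transitionSign f = c X * c Y) :
    (archGenuinePlus 𝔄 V (fun _ => true)).Cor510MonoTelecorePinnedIota :=
  (archGenuinePlus_monoTelecoreCoherence 𝔄 V (fun _ => true) c hc hcob).cor510MonoTelecorePinnedIota_of
    (archGenuinePlus_iotaData 𝔄 V (fun _ => true) c hc hcob)
    (archGenuinePlus_iotaData_squaresCommute 𝔄 V (fun _ => true) c hc hcob)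
    (archGenuinePlus_etaNatural 𝔄 c hc hcob V)

end LogFrobeniusSettingLtimes

namespace HolRS

/-- ★★★ **ZERO-HYPOTHESIS INSTANCE: at abc-iut-w5-d226's geometric Aut-holomorphic field functor, F-0139″ HOLDS at the genuine
archimedean `⋉`-carrier** (the orientation cochain exists there). [cite: MochizukiAbsTopIII2015, Cor 5.10 (iv)(c) p. 148] -/
theorem archGenuinePlus_cor510MonoTelecorePinnedIota_geometric (Q : ObjectProperty HolRS) (V : Type 1) [Nonempty V] :
    (LogFrobeniusSettingLtimes.archGenuinePlus (geometricAutHolFieldFunctor Q) V (fun _ => true)).Cor510MonoTelecorePinnedIota := by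
  obtain ⟨c, hc, hcob⟩ := exists_orientationCochain_geometric Q
  exact LogFrobeniusSettingLtimes.archGenuinePlus_cor510MonoTelecorePinnedIota _ V c hc hcob

/-- **Summary of the archimedean column of Cor 5.10 (iv) over the successor, concrete**: at the geometric functor and the
one-point all-archimedean index there is a `⋉`-carrier with `𝒩⊞_v = 𝒞^hol_{TH⊞}` at which (a) the mono-analytic cores, the
pinned (b)(c) row and F-0139″ all hold — no hypothesis. [cite: MochizukiAbsTopIII2015, Cor 5.10 (iv) p. 147] -/
theorem exists_ltimes_arc_carrier_cor510 (Q : ObjectProperty HolRS) :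
    ∃ L : LogFrobeniusSettingLtimes PUnit.{2} (fun _ => true),
      (∀ v, L.Nplus v = Up (HolTHPlusPair (geometricAutHolFieldFunctor Q))) ∧
      L.Cor510MonoCores ∧ L.Cor510MonoTelecorePinned ∧ L.Cor510MonoTelecorePinnedIota :=
  ⟨LogFrobeniusSettingLtimes.archGenuinePlus (geometricAutHolFieldFunctor Q) PUnit (fun _ => true), fun _ => rfl,
    LogFrobeniusSettingLtimes.archGenuinePlus_cor510MonoCores _ _ _,
    (archGenuinePlus_cor510MonoTelecorePinnedIota_geometric Q PUnit).cor510MonoTelecorePinned,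
    archGenuinePlus_cor510MonoTelecorePinnedIota_geometric Q PUnit⟩

end HolRS

end Literature.AnabelianGeometry.AbsoluteAnabelian

end
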